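import Literature.Analysis.FluidPDE.ForcedOseenMildUpToConst
import Literature.Analysis.FluidPDE.PeriodicOseenMildMeanZero
import Literature.Analysis.FluidPDE.ForcedPairsDivergencePairing
import Literature.Analysis.FluidPDE.ClassicalSolutionTorusProofs
import Literature.Analysis.FluidPDE.ClassicalSolutionGlue
import Literature.Analysis.FluidPDE.MildSolutionProofs
import Literature.Analysis.FluidPDE.NSBoundedMildSmoothing
import Literature.Analysis.FunctionSpaces.TorusSpaceTime
import Mathlib.Data.Fintype.Order
import HarnessLib

/-!
# A classical periodic solution with a divergence force is forced-Oseen-mild from every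
  positive base time

Analysis/FluidPDE support file (everything proved) for the perturbation step of M. P. Coiculescu,
S. Palasek, *Non-uniqueness of smooth solutions of the Navier–Stokes equations from critical data*,
Invent. Math. 244 (2025) = arXiv:2503.14699: by §4.1 eq. (4.1) the principal part `v` is a smooth
solution of Navier–Stokes on `(0, T] × 𝕋³` with the force `-ℙ div F` (in classical form: force
`-div F`, pressure absorbing the gradient part), and §5 ¶1 / the proof of Prop. 4.3 use its
Duhamel (mild) form. This file proves that mild form, on the lifted (periodic) fields and from an
arbitrary base time `s` inside the interval of smoothness:

* `Torus.lift_eq_forced_oseenMild` — if `(v, π)` is a classical solution on the torus on a time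
  set `S ⊇ [s, t]` (`s < t`) with force `-div F`, `F` jointly smooth, and `∫ v(t) = ∫ v(s)`, then
  for every `y`,
  `ṽ(t)(y) = e^{(t-s)Δ}ṽ(s)(y) - B¹_s(ṽ, ṽ)(t)(y) - Σ_{(i,j)} B¹_s(eⱼ, F̃ᵢⱼ eᵢ)(t)(y)`
  (`ṽ = lift ∘ v`, `F̃ᵢⱼ(τ) = lift Fᵢⱼ(τ)`, `B¹_s = oseenDuhamel 1 s`).

Proof: lift to `ℝᵈ` (`IsClassicalNSSolutionOn.of_torus_holds`), shift time by `s`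
(`comp_add_right`), pass to the duality form on `[0, t-s]` (`isMildNSSolutionOn_holds`, all fields
bounded by compactness of `[s,t] × 𝕋ᵈ`), write the tested force through the pairs `(eⱼ, F̃ᵢⱼeᵢ)`
(`intervalIntegral_inner_negMatrixDiv_heatTest_eq_neg_sum_oseenDuhamel`), conclude the Oseen form up
to a constant (`exists_const_forced_oseenMild_of_bounded_isMildNSSolutionOn`, KNSS 2009 Lemma 3.1),
kill the constant by the matching means (`Torus.oseenMild_const_eq_zero_of_integral_eq`), and
translate back (`oseenDuhamel_translate`).

## References

* M. P. Coiculescu, S. Palasek, Invent. Math. 244 (2025) = arXiv:2503.14699, §4.1 (4.1), §5 ¶1,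
  proof of Prop. 4.3 (Duhamel formula). [`CoiculescuPalasek2025`]
* G. Koch, N. Nadirashvili, G. Seregin, V. Šverák, Acta Math. 203 (2009) = arXiv:0709.3599,
  Lemma 3.1 / Rem. 3.1, §4 p. 8. [`KochNadirashviliSereginSverak2009`]
-/

noncomputable section

open MeasureTheory Set Function Filter TopologicalSpace InnerProductSpace Metric
open Literature.Analysis.FunctionSpaces
open _root_.Topology
open scoped RealInnerProductSpace NNReal ENNReal

namespace Literature.Analysis.FluidPDE

section Congr

variable {E : Type*} [NormedAddCommGroup E] [InnerProductSpace ℝ E] [FiniteDimensional ℝ E]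
  [MeasurableSpace E] [BorelSpace E]

/-- `B^ν_s(a, b)(t)` only sees the fields on the time window `(s, t)`. [folklore] -/
theorem oseenDuhamel_congr_of_eqOn_Ioo {ν s t : ℝ} {a a' b b' : ℝ → E → E}
    (ha : ∀ τ ∈ Ioo s t, a τ = a' τ) (hb : ∀ τ ∈ Ioo s t, b τ = b' τ) (x : E) :
    oseenDuhamel ν s a b t x = oseenDuhamel ν s a' b' t x := by
  rw [oseenDuhamel_apply, oseenDuhamel_apply]
  refine setIntegral_congr_fun measurableSet_Ioo fun τ hτ => ?_
  simp only [ha τ hτ, hb τ hτ]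

end Congr

variable {d : Type*} [Fintype d] [DecidableEq d]

/-- **A classical periodic solution with the force `-div F` is forced-Oseen-mild from every base
time** (the Duhamel formula for the principal part `v` of Coiculescu–Palasek, (4.1) ⇒ mild form).
Let `(v, π)` be a classical solution of Navier–Stokes (`ν = 1`) on the torus on the time set `S`
(a set of unique differentiability) with the force `fᵢ = -Σⱼ ∂ⱼFᵢⱼ`, `F` jointly smooth on
`S × 𝕋ᵈ`; let `s < t` with `[s, t] ⊆ S` and `∫ v(t) = ∫ v(s)`. Then for every `y ∈ ℝᵈ`,
`ṽ(t)(y) = e^{(t-s)Δ}ṽ(s)(y) - B¹_s(ṽ,ṽ)(t)(y) - Σ_{(i,j)} B¹_s(eⱼ, F̃ᵢⱼeᵢ)(t)(y)`, where `ṽ(τ)`,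
`F̃ᵢⱼ(τ)` are the periodic lifts. [cite: CoiculescuPalasek2025, §4.1 eq. (4.1) and proof of Prop. 4.3 (Duhamel formula); KochNadirashviliSereginSverak2009, Lemma 3.1 / Rem. 3.1] -/
theorem Torus.lift_eq_forced_oseenMild {S : Set ℝ}
    {v : ℝ → UnitAddTorus d → EuclideanSpace ℝ d} {π : ℝ → UnitAddTorus d → ℝ}
    {F : ℝ → UnitAddTorus d → d → d → ℝ}
    (hsol : Torus.IsClassicalNSSolutionOn S 1
      (fun t x => -(WithLp.toLp 2 fun i => ∑ j, Torus.partialDeriv j (fun y => F t y i j) x)) v π)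
    (hF : Torus.IsSmoothSpaceTimeOn S F) (hUS : UniqueDiffOn ℝ S)
    {s t : ℝ} (hst : s < t) (hS : Icc s t ⊆ S) (hmean : ∫ x, v t x = ∫ x, v s x)
    (y : EuclideanSpace ℝ d) :
    Torus.lift (v t) y =
      UnboundedOperators.heatExtension (Torus.lift (v s)) (t - s) y -
        oseenDuhamel 1 s (fun τ => Torus.lift (v τ)) (fun τ => Torus.lift (v τ)) t y -
        ∑ p : d × d, oseenDuhamel 1 s (fun _ _ => EuclideanSpace.single p.2 (1 : ℝ))
          (fun τ z => F τ (Torus.proj z) p.1 p.2 • EuclideanSpace.single p.1 (1 : ℝ)) t y := by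
  haveI : CompleteSpace (EuclideanSpace ℝ d) := FiniteDimensional.complete ℝ _
  -- notation
  set T' : ℝ := t - s with hT'def
  have hT' : 0 < T' := sub_pos.2 hst
  have hTs : T' + s = t := by rw [hT'def]; ring
  set f : ℝ → UnitAddTorus d → EuclideanSpace ℝ d := fun t x =>
    -(WithLp.toLp 2 fun i => ∑ j, Torus.partialDeriv j (fun y => F t y i j) x) with hfdef
  set Vl : ℝ → EuclideanSpace ℝ d → EuclideanSpace ℝ d := fun τ => Torus.lift (v τ) with hVl
  set u : ℝ → EuclideanSpace ℝ d → EuclideanSpace ℝ d := fun τ => Torus.lift (v (τ + s)) with hu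
  set fu : ℝ → EuclideanSpace ℝ d → EuclideanSpace ℝ d := fun τ => Torus.lift (f (τ + s)) with hfu
  set pu : ℝ → EuclideanSpace ℝ d → ℝ := fun τ => Torus.lift (π (τ + s)) with hpu
  have hshift : ∀ {τ : ℝ}, τ ∈ Icc 0 T' → τ + s ∈ Icc s t := fun hτ =>
    ⟨by linarith [hτ.1], by linarith [hτ.2, hTs]⟩
  have hIcc : Icc 0 T' ⊆ (· + s) ⁻¹' S := fun τ hτ => hS (hshift hτ)
  -- the lifted, shifted classical solution
  have hE : IsClassicalNSSolutionOn ((· + s) ⁻¹' S) 1 fu u pu :=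
    (IsClassicalNSSolutionOn.of_torus_holds hsol).comp_add_right s
  -- entries of `F` and their partial derivatives are jointly smooth
  have hFe : ∀ i j, Torus.IsSmoothSpaceTimeOn S (fun t x => F t x i j) := by
    intro i j
    exact ((ContinuousLinearMap.proj (R := ℝ) (φ := fun _ : d => ℝ) j).comp
      (ContinuousLinearMap.proj (R := ℝ) (φ := fun _ : d => d → ℝ) i)).contDiff.comp_contDiffOn hF
  have hdF : ∀ i j l, Torus.IsSmoothSpaceTimeOn S
      (fun t x => Torus.partialDeriv l (fun y => F t y i j) x) := fun i j l =>
    (hFe i j).partialDeriv hUS l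
  -- uniform bounds on `[s, t]`
  obtain ⟨Mv, hMv⟩ := hsol.smooth_velocity.exists_norm_le_of_isCompact isCompact_Icc hS
  obtain ⟨Mπ, hMπ⟩ := hsol.smooth_pressure.exists_norm_le_of_isCompact isCompact_Icc hS
  obtain ⟨MF, hMF⟩ := hF.exists_norm_le_of_isCompact isCompact_Icc hS
  have hbdF : ∀ i j l, ∃ C : ℝ, ∀ τ ∈ Icc s t, ∀ x,
      ‖Torus.partialDeriv l (fun y => F τ y i j) x‖ ≤ C := fun i j l =>
    (hdF i j l).exists_norm_le_of_isCompact isCompact_Icc hS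
  choose C' hC' using hbdF
  obtain ⟨Mg', hMg'⟩ := Finite.exists_le (fun q : d × d × d => C' q.1 q.2.1 q.2.2)
  have hdFle : ∀ i j l, ∀ τ ∈ Icc s t, ∀ x,
      |Torus.partialDeriv l (fun y => F τ y i j) x| ≤ Mg' := fun i j l τ hτ x => by
    rw [← Real.norm_eq_abs]
    exact (hC' i j l τ hτ x).trans (hMg' (i, j, l))
  have hFle : ∀ τ ∈ Icc s t, ∀ x i j, |F τ x i j| ≤ MF := fun τ hτ x i j => by
    rw [← Real.norm_eq_abs]
    exact ((norm_le_pi_norm (F τ x i) j).trans (norm_le_pi_norm (F τ x) i)).trans (hMF τ hτ x)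
  -- continuity of the force on `S × 𝕋ᵈ` and its bound
  have hfc : ContinuousOn (Torus.stLift f) (S ×ˢ univ) := by
    have h1 : ∀ i, ContinuousOn (fun q : ℝ × EuclideanSpace ℝ d =>
        ∑ j, Torus.partialDeriv j (fun y => F q.1 y i j) (Torus.proj q.2)) (S ×ˢ univ) :=
      fun i => continuousOn_finsetSum _ fun j _ => (hdF i j j).continuousOn_stLift
    have h2 : ContinuousOn (fun q : ℝ × EuclideanSpace ℝ d => fun i =>
        ∑ j, Torus.partialDeriv j (fun y => F q.1 y i j) (Torus.proj q.2)) (S ×ˢ univ) :=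
      continuousOn_pi.2 h1
    exact ((PiLp.continuous_toLp 2 _).comp_continuousOn h2).neg
  obtain ⟨Mf, hMf⟩ := Torus.exists_norm_le_of_continuousOn_of_isCompact hfc isCompact_Icc hS
  -- boundedness of the shifted lifted fields on `[0, T']`
  have hbu : IsBoundedOn (Icc 0 T') u := ⟨Mv, fun τ hτ z => hMv _ (hshift hτ) _⟩
  have hbp : IsBoundedOn (Icc 0 T') pu := ⟨Mπ, fun τ hτ z => hMπ _ (hshift hτ) _⟩
  have hbf : IsBoundedOn (Icc 0 T') fu := ⟨Mf, fun τ hτ z => hMf _ (hshift hτ) _⟩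
  -- the duality form on `[0, T']`
  have hmildIcc : IsMildNSSolutionOn (Icc 0 T') 1 fu (u 0) u :=
    IsClassicalNSSolutionOn.isMildNSSolutionOn_holds (T := T') hE one_pos hIcc hbu hbp hbf
  have hmild : IsMildNSSolutionOn (Ioc 0 T') 1 fu (u 0) u :=
    ⟨fun τ hτ => hmildIcc.1 τ ⟨hτ.1.le, hτ.2⟩, fun τ hτ => hmildIcc.2 τ ⟨hτ.1.le, hτ.2⟩⟩
  -- the truncated, shifted, lifted tensor
  set G : ℝ → EuclideanSpace ℝ d → d → d → ℝ := fun τ z i j =>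
    if τ ∈ Icc 0 T' then F (τ + s) (Torus.proj z) i j else 0 with hG
  have hGeq : ∀ τ ∈ Icc 0 T', ∀ z i j, G τ z i j = F (τ + s) (Torus.proj z) i j :=
    fun τ hτ z i j => if_pos hτ
  have hGfun : ∀ τ ∈ Icc 0 T', ∀ i j,
      (fun z => G τ z i j) = Torus.lift (fun x => F (τ + s) x i j) := fun τ hτ i j =>
    funext fun z => by rw [hGeq τ hτ, Torus.lift_apply]
  have hGm : ∀ i j, Measurable fun q : ℝ × EuclideanSpace ℝ d => G q.1 q.2 i j := by
    intro i j
    have hc : ContinuousOn (fun q : ℝ × EuclideanSpace ℝ d => F (q.1 + s) (Torus.proj q.2) i j)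
        (Icc 0 T' ×ˢ univ) := by
      have h1 := (hFe i j).continuousOn_stLift
      have hφ : Continuous fun q : ℝ × EuclideanSpace ℝ d => ((q.1 + s, q.2) : ℝ × EuclideanSpace ℝ d) :=
        by fun_prop
      exact h1.comp hφ.continuousOn fun q hq => ⟨hIcc (mem_prod.1 hq).1, mem_univ _⟩
    have heq : (fun q : ℝ × EuclideanSpace ℝ d => G q.1 q.2 i j) =
        (Icc 0 T' ×ˢ (univ : Set (EuclideanSpace ℝ d))).piecewise
          (fun q => F (q.1 + s) (Torus.proj q.2) i j) 0 := by
      funext q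
      by_cases hq : q.1 ∈ Icc 0 T'
      · rw [Set.piecewise_eq_of_mem _ _ _ (mk_mem_prod hq (mem_univ q.2))]
        exact hGeq q.1 hq q.2 i j
      · rw [Set.piecewise_eq_of_notMem _ _ _ (fun hm => hq (mem_prod.1 hm).1)]
        exact if_neg hq
    rw [heq]
    exact hc.measurable_piecewise continuousOn_const (measurableSet_Icc.prod MeasurableSet.univ)
  have hGd : ∀ τ ∈ Ioo 0 T', ∀ i j, Differentiable ℝ fun z => G τ z i j := by
    intro τ hτ i j
    rw [hGfun τ (Ioo_subset_Icc_self hτ)]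
    exact ((hFe i j).isSmooth_slice (hS (hshift (Ioo_subset_Icc_self hτ)))).differentiable
      (by simp)
  have hGMall : ∀ τ z i j, |G τ z i j| ≤ max 1 (max Mv MF) := by
    intro τ z i j
    by_cases hτ : τ ∈ Icc 0 T'
    · rw [hGeq τ hτ]
      exact (hFle _ (hshift hτ) _ i j).trans ((le_max_right _ _).trans (le_max_right _ _))
    · simp only [hG, if_neg hτ, abs_zero]
      exact zero_le_one.trans (le_max_left _ _)
  have hGM : ∀ τ ∈ Ioo 0 T', ∀ z i j, |G τ z i j| ≤ max 1 (max Mv MF) := fun τ _ z i j =>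
    hGMall τ z i j
  -- directional derivatives of the lifted entries are lifted partial derivatives
  have hGderiv : ∀ τ ∈ Icc 0 T', ∀ z i j l,
      fderiv ℝ (fun z => G τ z i j) z (EuclideanSpace.single l (1 : ℝ)) =
        Torus.partialDeriv l (fun x => F (τ + s) x i j) (Torus.proj z) := by
    intro τ hτ z i j l
    have h1 : Torus.IsContDiff 1 (fun x => F (τ + s) x i j) :=
      ((hFe i j).isSmooth_slice (hS (hshift hτ))).isContDiff (by exact_mod_cast le_top)
    have h2 := Torus.lift_lineDeriv h1 (EuclideanSpace.single l (1 : ℝ))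
    rw [hGfun τ hτ i j, ← Torus.lift_apply (fun x => Torus.partialDeriv l (fun x => F (τ + s) x i j) x) z]
    exact (congrFun h2 z).symm
  have hGM' : ∀ τ ∈ Ioo 0 T', ∀ z i j,
      |fderiv ℝ (fun z => G τ z i j) z (EuclideanSpace.single j (1 : ℝ))| ≤ Mg' := by
    intro τ hτ z i j
    rw [hGderiv τ (Ioo_subset_Icc_self hτ)]
    exact hdFle i j j _ (hshift (Ioo_subset_Icc_self hτ)) _
  have hfG : ∀ τ ∈ Ioo 0 T', ∀ z, fu τ z = -(WithLp.toLp 2 fun i => ∑ j,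
      fderiv ℝ (fun z => G τ z i j) z (EuclideanSpace.single j (1 : ℝ))) := by
    intro τ hτ z
    simp only [hfu, hfdef, Torus.lift_apply]
    congr 1
    congr 1
    funext i
    exact Finset.sum_congr rfl fun j _ => (hGderiv τ (Ioo_subset_Icc_self hτ) z i j j).symm
  -- the Oseen–Duhamel pairs `(eⱼ, Gᵢⱼ eᵢ)`
  set a : d × d → ℝ → EuclideanSpace ℝ d → EuclideanSpace ℝ d := fun p _ _ =>
    EuclideanSpace.single p.2 (1 : ℝ) with ha
  set b : d × d → ℝ → EuclideanSpace ℝ d → EuclideanSpace ℝ d := fun p τ z =>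
    G τ z p.1 p.2 • EuclideanSpace.single p.1 (1 : ℝ) with hb
  have ham' : ∀ p, Measurable (uncurry (a p)) := fun p => measurable_const
  have hbm' : ∀ p, Measurable (uncurry (b p)) := fun p => (hGm p.1 p.2).smul_const _
  have haMall : ∀ p τ z, ‖a p τ z‖ ≤ max 1 (max Mv MF) := fun p τ z => by
    simp only [ha, PiLp.norm_single, norm_one]
    exact le_max_left _ _
  have hbMall : ∀ p τ z, ‖b p τ z‖ ≤ max 1 (max Mv MF) := fun p τ z => by
    simp only [hb, norm_smul, PiLp.norm_single, norm_one, mul_one, Real.norm_eq_abs]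
    exact hGMall τ z p.1 p.2
  have hMpos : 0 < max 1 (max Mv MF) := lt_of_lt_of_le zero_lt_one (le_max_left _ _)
  -- the force term in pair form
  have hpair : ∀ t' ∈ Ioc 0 T', ∀ φ : EuclideanSpace ℝ d → EuclideanSpace ℝ d,
      FunctionSpaces.IsTestFunctionOn (⊤ : Opens (EuclideanSpace ℝ d)) φ →
      VectorCalculus.IsDivFree φ →
      (∫ τ in (0 : ℝ)..t', ∫ x, ⟪fu τ x, heatTest 1 φ (t' - τ) x⟫) =
        -∑ p, ∫ x, ⟪oseenDuhamel 1 0 (a p) (b p) t' x, φ x⟫ := fun t' ht' φ hφ hdiv =>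
    intervalIntegral_inner_negMatrixDiv_heatTest_eq_neg_sum_oseenDuhamel one_pos hGm hGd hGM hGM'
      hfG ht' hφ hdiv
  -- measurability and bounds of `u`
  have hcontu : ContinuousOn (uncurry u) (Icc 0 T' ×ˢ univ) :=
    hE.smooth_velocity.continuousOn.mono (prod_mono hIcc subset_rfl)
  have hmeas : AEStronglyMeasurable (uncurry u)
      ((volume : Measure (ℝ × EuclideanSpace ℝ d)).restrict (Ioo 0 T' ×ˢ univ)) :=
    (hcontu.mono (prod_mono Ioo_subset_Icc_self subset_rfl)).aestronglyMeasurable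
      (measurableSet_Ioo.prod MeasurableSet.univ)
  have hslice : ∀ τ ∈ Icc s t, Continuous (Torus.lift (v τ)) := fun τ hτ =>
    Torus.continuous_lift_iff.2 (hsol.smooth_velocity.isSmooth_slice (hS hτ)).continuous
  have hsl : ∀ τ ∈ Icc 0 T', AEStronglyMeasurable (u τ) volume := fun τ hτ =>
    (hslice _ (hshift hτ)).aestronglyMeasurable
  have hbd : ∀ τ ∈ Icc 0 T', ∀ z, ‖u τ z‖ ≤ max 1 (max Mv MF) := fun τ hτ z =>
    (hMv _ (hshift hτ) _).trans ((le_max_left _ _).trans (le_max_right _ _))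
  have hdiv0 : IsWeaklyDivFree (u 0) := hmildIcc.1 0 ⟨le_rfl, hT'.le⟩
  -- (A1): the Oseen form up to a constant
  obtain ⟨c, hc⟩ := exists_const_forced_oseenMild_of_bounded_isMildNSSolutionOn one_pos hT' hmild
    hmeas hsl hMpos hbd hdiv0 (fun p => (ham' p).aestronglyMeasurable)
    (fun p => (hbm' p).aestronglyMeasurable) hMpos (fun p τ _ z => haMall p τ z)
    (fun p τ _ z => hbMall p τ z) hpair (t := T') ⟨hT', le_rfl⟩
  -- the truncated field (globally bounded and measurable) for the mean computation
  set u' : ℝ → EuclideanSpace ℝ d → EuclideanSpace ℝ d := fun τ z =>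
    if τ ∈ Icc 0 T' then u τ z else 0 with hu'
  have hu'eq : ∀ τ ∈ Icc 0 T', u' τ = u τ := fun τ hτ => funext fun z => if_pos hτ
  have hu'm : Measurable (uncurry u') := by
    have heq : uncurry u' = (Icc 0 T' ×ˢ (univ : Set (EuclideanSpace ℝ d))).piecewise
        (uncurry u) 0 := by
      funext q
      by_cases hq : q.1 ∈ Icc 0 T'
      · rw [Set.piecewise_eq_of_mem _ _ _ (mk_mem_prod hq (mem_univ q.2))]
        exact if_pos hq
      · rw [Set.piecewise_eq_of_notMem _ _ _ (fun hm => hq (mem_prod.1 hm).1)]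
        exact if_neg hq
    rw [heq]
    exact hcontu.measurable_piecewise continuousOn_const (measurableSet_Icc.prod MeasurableSet.univ)
  have hu'M : ∀ τ z, ‖u' τ z‖ ≤ max 1 (max Mv MF) := by
    intro τ z
    by_cases hτ : τ ∈ Icc 0 T'
    · rw [hu'eq τ hτ]; exact hbd τ hτ z
    · simp only [hu', if_neg hτ, norm_zero]; exact hMpos.le
  have hDu : ∀ z, oseenDuhamel 1 0 u u T' z = oseenDuhamel 1 0 u' u' T' z := fun z =>
    oseenDuhamel_congr_of_eqOn_Ioo (fun τ hτ => (hu'eq τ (Ioo_subset_Icc_self hτ)).symm)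
      (fun τ hτ => (hu'eq τ (Ioo_subset_Icc_self hτ)).symm) z
  -- torus representatives of the slices
  have hUs : ∀ σ ∈ Ioo 0 T', Continuous (v (σ + s)) := fun σ hσ =>
    Torus.continuous_lift_iff.1 (hslice _ (hshift (Ioo_subset_Icc_self hσ)))
  have hliftu : ∀ σ ∈ Ioo 0 T', Torus.lift (v (σ + s)) = u' σ := fun σ hσ => by
    rw [hu'eq σ (Ioo_subset_Icc_self hσ)]
  have hAs : ∀ p : d × d, ∀ σ ∈ Ioo 0 T',
      Continuous (fun _ : UnitAddTorus d => EuclideanSpace.single p.2 (1 : ℝ)) :=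
    fun p σ _ => continuous_const
  have hlifta : ∀ p : d × d, ∀ σ ∈ Ioo 0 T',
      Torus.lift (fun _ : UnitAddTorus d => EuclideanSpace.single p.2 (1 : ℝ)) = a p σ :=
    fun p σ _ => funext fun z => rfl
  have hBs : ∀ p : d × d, ∀ σ ∈ Ioo 0 T',
      Continuous (fun x : UnitAddTorus d => F (σ + s) x p.1 p.2 • EuclideanSpace.single p.1 (1 : ℝ)) := by
    intro p σ hσ
    exact ((hFe p.1 p.2).isSmooth_slice (hS (hshift (Ioo_subset_Icc_self hσ)))).continuous.smul
      continuous_const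
  have hliftb : ∀ p : d × d, ∀ σ ∈ Ioo 0 T',
      Torus.lift (fun x : UnitAddTorus d => F (σ + s) x p.1 p.2 • EuclideanSpace.single p.1 (1 : ℝ)) =
        b p σ := by
    intro p σ hσ
    funext z
    simp only [hb, Torus.lift_apply, hGeq σ (Ioo_subset_Icc_self hσ)]
  have hU : Continuous (v (0 + s)) := by
    rw [zero_add]; exact Torus.continuous_lift_iff.1 (hslice s ⟨le_rfl, hst.le⟩)
  have hW : Continuous (v (T' + s)) := by
    rw [hTs]; exact Torus.continuous_lift_iff.1 (hslice t ⟨hst.le, le_rfl⟩)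
  have hmean' : ∫ x, v (T' + s) x = ∫ x, v (0 + s) x := by rw [hTs, zero_add]; exact hmean
  have hUM : ∀ x, ‖v (0 + s) x‖ ≤ max 1 (max Mv MF) := fun x => by
    have h := hbd 0 ⟨le_rfl, hT'.le⟩ (Torus.repr x)
    simpa only [hu, Torus.lift_apply, Torus.proj_repr] using h
  have hae : Torus.lift (v (T' + s)) =ᵐ[volume] fun z =>
      UnboundedOperators.heatExtension (Torus.lift (v (0 + s))) (1 * T') z -
        oseenDuhamel 1 0 u' u' T' z - (∑ p, oseenDuhamel 1 0 (a p) (b p) T' z) - c := by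
    refine hc.trans (Eventually.of_forall fun z => ?_)
    beta_reduce
    rw [hDu z]
  obtain ⟨-, hall⟩ := Torus.oseenMild_const_eq_zero_of_integral_eq one_pos hT' hMpos.le hU hW hmean'
    hu'm hu'M hUs hliftu ham' hbm' (fun p σ z => haMall p σ z) (fun p σ z => hbMall p σ z)
    hAs hBs hlifta hliftb hUM hae
  -- translate back to the base time `s`
  have h1 : Torus.lift (v t) y = Torus.lift (v (T' + s)) y := by rw [hTs]
  have h2 : UnboundedOperators.heatExtension (Torus.lift (v (0 + s))) (1 * T') y =
      UnboundedOperators.heatExtension (Torus.lift (v s)) (t - s) y := by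
    rw [zero_add, one_mul]
  have h3 : oseenDuhamel 1 0 u' u' T' y = oseenDuhamel 1 s Vl Vl t y := by
    rw [← hDu y]
    have h := oseenDuhamel_translate 1 0 s Vl Vl T' y
    rw [zero_add, hTs] at h
    exact h
  have h4 : ∀ p : d × d, oseenDuhamel 1 0 (a p) (b p) T' y =
      oseenDuhamel 1 s (fun _ _ => EuclideanSpace.single p.2 (1 : ℝ))
        (fun τ z => F τ (Torus.proj z) p.1 p.2 • EuclideanSpace.single p.1 (1 : ℝ)) t y := by
    intro p
    have hb' : ∀ τ ∈ Ioo 0 T', b p τ =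
        (fun σ (z : EuclideanSpace ℝ d) => F σ (Torus.proj z) p.1 p.2 • EuclideanSpace.single p.1 (1 : ℝ))
          (τ + s) := fun τ hτ =>
      funext fun z => by simp only [hb, hGeq τ (Ioo_subset_Icc_self hτ)]
    rw [oseenDuhamel_congr_of_eqOn_Ioo (a' := fun τ => (fun (_ : ℝ) (_ : EuclideanSpace ℝ d) =>
      EuclideanSpace.single p.2 (1 : ℝ)) (τ + s)) (fun τ _ => rfl) hb' y]
    have h := oseenDuhamel_translate 1 0 s
      (fun (_ : ℝ) (_ : EuclideanSpace ℝ d) => EuclideanSpace.single p.2 (1 : ℝ))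
      (fun σ (z : EuclideanSpace ℝ d) => F σ (Torus.proj z) p.1 p.2 • EuclideanSpace.single p.1 (1 : ℝ))
      T' y
    rw [zero_add, hTs] at h
    exact h
  rw [h1, hall y, h2, h3, Finset.sum_congr rfl fun p _ => h4 p]

end Literature.Analysis.FluidPDE
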